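import Summits.BirchSwinnertonDyer.BirchSwinnertonDyer.Theorems.GenusKolyvaginAtTwoPowDvdShaCardAtTwoRTRungSupplySeparation
import Summits.BirchSwinnertonDyer.BirchSwinnertonDyer.Theorems.Rank1ResidualJetCompatibleDataDown
import HarnessLib

/-!
# Route `GenusKolyvaginAtTwo`, LINE 18 (L_T `PowDvdShaCardAtTwoRT`, stmt-BirchSwinnertonDyer-23242), stub L
# `stub_twinShaLaddersAtTwo` — THE K-SIDE SUPPLY, INTRINSIC FORM: no sub-data to carry (Gross's one system of choices is
# RECONSTRUCTED downwards, `JET.exists_compatible_datum_of_dvd_of_grossCM`)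

Seat `bsd-line-gk2-p2` g18 (PROVER seat 2/3, cell `bsd-f1-sign2`), `--supports stmt-BirchSwinnertonDyer-23242` (helper; closes
nothing). THEOREMS ONLY (no definition, no named fact, no `sorry`); BSD is not proved by any of this.

WHY. `…RTRungSupplyKolyvagin` / `…RTRungSupplyShape` / `…RTRungSupplySeparation` display, next to the datum `d` at `n`, data at the
levels `n/ℓ` COHERENT with `d` (four clauses) — the input of Q2. The tree constructs such data unconditionally
(`JET.exists_compatible_datum_of_dvd_of_grossCM`, cell `bsd-jet`: restrict Gross's choices `σ_ℓ`, `S`, `K[n] ⊂ K̄` down the tower; the CM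
point `y(n/ℓ)` from `phi_heegnerPointOfConductor_mem_range_map_ringClassField_holds`). So the sub-data can be ELIMINATED from the
supply hypotheses, provided the divisibility input is stated for EVERY datum at `n/ℓ` — which is what the definition of `M_{r−1}` as a
MINIMUM over all data at all `(r−1)`-fold products gives anyway («`2^{M_{r−1}} ∣ P(n/ℓ)`» for any system of choices):

* §1 **`zsmul_kolyvaginClass_two_mem_selmerGroup_of_forall`**, `zsmul_kolyvaginClass_two_mem_torsionLocalKer_of_forall` — `hsel` and
  own-prime vanishing for `2^j c_L(n)` from `∀ ℓ ∣ n, ∀ e (datum at n/ℓ), 2^j c_L(e) = 0`.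
* §2 **`avoidance_of_kolyvaginSupply_intrinsic`** — Prop. 5.2 at `2` in the LIGHTEST tree shape: for every `C = ⟨u⟩ ⊔ C₀` (`≤ b`
  Selmer classes of sign `ε`) SOME square-free `n` (Kolyvagin primes of index `≥ L`) and datum `d` with
  `∀ ℓ ∣ n, ∀ e, 2^{L−M'} c_L(e) = 0`, `ord c_L(n) = 2^{L−k}`, sign `ε`, and EITHER `⟨2^{L−M'} c_L(n)⟩ ∩ C = 0` (avoidance of the supply element
  itself — weaker than `⟨c_L(n)⟩ ∩ C = 0`) — ⟹ the avoidance binder; **`avoidance_of_kolyvaginSupply_of_separation_intrinsic`** — OR the own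
  primes of `n` separate `C` (the swap loop's output).

References: [McCallumLMS1991] §5 p. 285, Prop. 5.2 (proof, p. 310), Prop. 4.4; [GrossLMS1991] §3–§4 (one system of choices), Prop. 6.2.
-/

set_option autoImplicit false
-- the Theorems namespace of this sub repeats the summit name by design (D-0017 nested layout)
set_option linter.dupNamespace false

noncomputable section

open scoped Classical

namespace Summit.BirchSwinnertonDyer.BirchSwinnertonDyer.Theorems.GenusExact.PlusDescent

open WeierstrassCurve NumberField IsDedekindDomain Field Literature.NumberTheory.EllipticCurves
  Literature.NumberTheory.GaloisRepresentations Literature.NumberTheory.EllipticCurves.ModularForms AddSubgroup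
open Summit.BirchSwinnertonDyer.BirchSwinnertonDyer.Theses.GenusKolyvaginAtTwo (KolyvaginRelationAtTwo)
open Summit.BirchSwinnertonDyer.Rank1Residual

variable {K : Type} [Field K] [NumberField K] (W : WeierstrassCurve ℚ) [W.IsElliptic] [W.IsGloballyMinimal]
  [NeZero (W.conductorNorm ℤ)] (Dt : ModularParametrizationData W (W.conductorNorm ℤ)) (β : ℤ) (ι : K →+* ℂ)
  (τ : K ≃ₐ[ℚ] K) (L : ℕ)

/-! ## §1 `hsel` and own-prime vanishing without sub-data -/

/-- **`loc_v (2^j c_L(n)) = 0` at `v ∣ ℓ ∣ n`, intrinsic form**: if `2^j c_L(e) = 0` for EVERY datum `e` at `n/ℓ`, then — choosing a datum at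
`n/ℓ` coherent with `d` (`JET.exists_compatible_datum_of_dvd_of_grossCM`) — Q2 gives the vanishing. [cite: McCallumLMS1991, §4 Prop. 4.4]
[cite: GrossLMS1991, §3–§4] -/
theorem zsmul_kolyvaginClass_two_mem_torsionLocalKer_of_forall (hQ2 : KolyvaginRelationAtTwo) (hcm : ¬ W.HasCM)
    (hK : IsImaginaryQuadratic K) (hne3 : NumberField.discr K ≠ -3) (hne4 : NumberField.discr K ≠ -4)
    (hH : SatisfiesHeegnerHypothesis (W.conductorNorm ℤ) K) (hsur : ∀ m : ℕ, W.HasSurjectiveModNGaloisRep (2 ^ m : ℕ))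
    {L : ℕ} (hL : 1 ≤ L) (j : ℕ) {n : ℕ} (hn : Squarefree n)
    (hKol : ∀ ℓ ∈ n.primeFactors, Zhang2014.IsKolyvaginPrime (W.conductorNorm ℤ) W K 2 ℓ ∧ L ≤ Zhang2014.kolyvaginIndex W 2 ℓ)
    (d : KolyvaginHeegnerData Dt β ι n)
    (hsub : ∀ ℓ ∈ n.primeFactors, ∀ e : KolyvaginHeegnerData Dt β ι (n / ℓ), ((2 ^ j : ℕ) : ℤ) • e.kolyvaginClass Nat.prime_two L = 0)
    {ℓ : ℕ} (hℓ : ℓ ∈ n.primeFactors) (v : HeightOneSpectrum (𝓞 K)) (hv : ((ℓ : ℕ) : 𝓞 K) ∈ v.asIdeal) :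
    ((2 ^ j : ℕ) : ℤ) • d.kolyvaginClass Nat.prime_two L ∈
      (W.baseChange K).torsionLocalKer (v.adicCompletion K) ((2 ^ L : ℕ) : ℤ) := by
  have hD : NumberField.discr K < -4 := X11b.KolyvaginAssembly.discr_lt_neg_four hK ⟨hne3, hne4⟩
  obtain ⟨e, hσ, hS, hS', hemb⟩ := JET.exists_compatible_datum_of_dvd_of_grossCM hK hD hH 2 Dt β ι hn (fun l hl ↦ (hKol l hl).1)
    (Nat.div_dvd_of_dvd (Nat.dvd_of_mem_primeFactors hℓ)) d
  exact zsmul_kolyvaginClass_two_mem_torsionLocalKer W Dt β ι hQ2 hcm hK hne3 hne4 hH hsur hL j hn hKol d hℓ e hσ hS hS' hemb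
    (hsub ℓ hℓ e) v hv

/-- **`2^j c_L(n) ∈ Sel^{(2^L)}(E_K/K)`, intrinsic form** (McCallum's `hsel` at `2`): `2^j c_L(e) = 0` for every datum `e` at every `n/ℓ`
(`2^{L−j} ∣ P(n/ℓ)` for any system of choices) ⟹ Selmer. [cite: McCallumLMS1991, §4 Lemma 4.3, Prop. 4.4; §5 p. 285]
[cite: GrossLMS1991, Prop. 6.2] -/
theorem zsmul_kolyvaginClass_two_mem_selmerGroup_of_forall (hQ2 : KolyvaginRelationAtTwo) (hcm : ¬ W.HasCM)
    (hK : IsImaginaryQuadratic K) (hne3 : NumberField.discr K ≠ -3) (hne4 : NumberField.discr K ≠ -4)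
    (hH : SatisfiesHeegnerHypothesis (W.conductorNorm ℤ) K) (hodd : Odd W.tamagawaProduct)
    (hsur : ∀ m : ℕ, W.HasSurjectiveModNGaloisRep (2 ^ m : ℕ))
    {L : ℕ} (hL : 1 ≤ L) (j : ℕ) {n : ℕ} (hn : Squarefree n)
    (hKol : ∀ ℓ ∈ n.primeFactors, Zhang2014.IsKolyvaginPrime (W.conductorNorm ℤ) W K 2 ℓ ∧ L ≤ Zhang2014.kolyvaginIndex W 2 ℓ)
    (d : KolyvaginHeegnerData Dt β ι n)
    (hsub : ∀ ℓ ∈ n.primeFactors, ∀ e : KolyvaginHeegnerData Dt β ι (n / ℓ), ((2 ^ j : ℕ) : ℤ) • e.kolyvaginClass Nat.prime_two L = 0) :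
    ((2 ^ j : ℕ) : ℤ) • d.kolyvaginClass Nat.prime_two L ∈ selmerGroup (W.baseChange K) ((2 ^ L : ℕ) : ℤ) := by
  have hD : NumberField.discr K < -4 := X11b.KolyvaginAssembly.discr_lt_neg_four hK ⟨hne3, hne4⟩
  have hdata : ∀ ℓ ∈ n.primeFactors, ∃ e : KolyvaginHeegnerData Dt β ι (n / ℓ),
      (∀ l' ∈ (n / ℓ).primeFactors, ∀ (x : ringClassField K ι (n / ℓ)) (x' : ringClassField K ι n),
        (x : ℂ) = x' → ((d.σ l' x' : ringClassField K ι n) : ℂ) = (e.σ l' x : ℂ)) ∧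
      (∀ s ∈ e.S, ∃ s' ∈ d.S, ∀ (x : ringClassField K ι (n / ℓ)) (x' : ringClassField K ι n),
        (x : ℂ) = x' → ((s' x' : ringClassField K ι n) : ℂ) = (s x : ℂ)) ∧
      (∀ s' ∈ d.S, ∃ s ∈ e.S, ∀ (x : ringClassField K ι (n / ℓ)) (x' : ringClassField K ι n),
        (x : ℂ) = x' → ((s' x' : ringClassField K ι n) : ℂ) = (s x : ℂ)) ∧
      (∀ (x : ringClassField K ι (n / ℓ)) (x' : ringClassField K ι n), (x : ℂ) = x' → d.emb x' = e.emb x) := fun ℓ hℓ ↦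
    JET.exists_compatible_datum_of_dvd_of_grossCM hK hD hH 2 Dt β ι hn (fun l hl ↦ (hKol l hl).1)
      (Nat.div_dvd_of_dvd (Nat.dvd_of_mem_primeFactors hℓ)) d
  choose dsub hσ hS hS' hemb using hdata
  exact zsmul_kolyvaginClass_two_mem_selmerGroup W Dt β ι hQ2 hcm hK hne3 hne4 hH hodd hsur hL j hn hKol d dsub hσ hS hS' hemb
    (fun ℓ hℓ ↦ hsub ℓ hℓ (dsub ℓ hℓ))

/-! ## §2 Prop. 5.2 at `2` in the lightest shapes ⟹ the avoidance binders -/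

/-- **PROP. 5.2 AT `2`, INTRINSIC AVOIDANCE FORM ⟹ the avoidance binder** (sign `ε`, seed `C₀`, `(s, a) = (b+1, M'−k)`). The hypothesis
`hP52` asks, for each `C = ⟨u⟩ ⊔ C₀`, a square-free `n`, a datum `d`, «`2^{L−M'} c_L(e) = 0` for all data `e` at the `n/ℓ`», `ord c_L(n) = 2^{L−k}`,
sign `ε` and `⟨2^{L−M'} c_L(n)⟩ ∩ C = 0`. [cite: McCallumLMS1991, §5 Prop. 5.2, p. 285] -/
theorem avoidance_of_kolyvaginSupply_intrinsic (hQ2 : KolyvaginRelationAtTwo) (hcm : ¬ W.HasCM)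
    (hK : IsImaginaryQuadratic K) (hne3 : NumberField.discr K ≠ -3) (hodd' : Odd (NumberField.discr K))
    (hH : SatisfiesHeegnerHypothesis (W.conductorNorm ℤ) K) (hodd : Odd W.tamagawaProduct)
    (hsur : ∀ m : ℕ, W.HasSurjectiveModNGaloisRep (2 ^ m : ℕ)) (hτ : τ ≠ 1)
    (ε : ℤ) {M' k b : ℕ} (hL : 1 ≤ L) (hkM : k ≤ M') (hML : M' ≤ L)
    (C₀ : AddSubgroup (galH1Torsion (W.baseChange K) ((2 ^ L : ℕ) : ℤ)))
    (hP52 : ∀ (i : ℕ) (u : Fin i → galH1Torsion (W.baseChange K) ((2 ^ L : ℕ) : ℤ)), i ≤ b →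
      (∀ j, u j ∈ selmerGroup (W.baseChange K) ((2 ^ L : ℕ) : ℤ) ∧ conjAct W τ ((2 ^ L : ℕ) : ℤ) (u j) = ε • u j) →
      ∃ (n : ℕ) (_ : Squarefree n)
        (_ : ∀ ℓ ∈ n.primeFactors, Zhang2014.IsKolyvaginPrime (W.conductorNorm ℤ) W K 2 ℓ ∧ L ≤ Zhang2014.kolyvaginIndex W 2 ℓ)
        (d : KolyvaginHeegnerData Dt β ι n),
        (∀ ℓ ∈ n.primeFactors, ∀ e : KolyvaginHeegnerData Dt β ι (n / ℓ),
          ((2 ^ (L - M') : ℕ) : ℤ) • e.kolyvaginClass Nat.prime_two L = 0) ∧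
        addOrderOf (d.kolyvaginClass Nat.prime_two L) = 2 ^ (L - k) ∧
        -W.rootNumber * (-1) ^ n.primeFactors.card = ε ∧
        Disjoint (zmultiples (((2 ^ (L - M') : ℕ) : ℤ) • d.kolyvaginClass Nat.prime_two L))
          (AddSubgroup.closure (Set.range u) ⊔ C₀)) :
    ∀ i < b + 1, ∀ u : Fin i → galH1Torsion (W.baseChange K) ((2 ^ L : ℕ) : ℤ),
      (∀ j, u j ∈ selmerGroup (W.baseChange K) ((2 ^ L : ℕ) : ℤ) ∧ conjAct W τ ((2 ^ L : ℕ) : ℤ) (u j) = ε • u j) →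
      (∀ j, addOrderOf (u j) = 2 ^ (M' - k)) →
      ∃ y : galH1Torsion (W.baseChange K) ((2 ^ L : ℕ) : ℤ),
        (y ∈ selmerGroup (W.baseChange K) ((2 ^ L : ℕ) : ℤ) ∧ conjAct W τ ((2 ^ L : ℕ) : ℤ) y = ε • y) ∧
        addOrderOf y = 2 ^ (M' - k) ∧ Disjoint (zmultiples y) (AddSubgroup.closure (Set.range u) ⊔ C₀) := by
  have hne4 : NumberField.discr K ≠ -4 := fun h ↦ by
    rw [h] at hodd'
    exact (Int.not_even_iff_odd.mpr hodd') ⟨-2, by norm_num⟩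
  have hsurj1 : W.HasSurjectiveModNGaloisRep ((2 : ℤ) ^ 1) := by exact_mod_cast hsur 1
  intro i hi u hu _
  obtain ⟨n, hn, hKol, d, hsub, hordc, hsign, hdisj⟩ := hP52 i u (Nat.lt_succ_iff.mp hi) hu
  refine ⟨((2 ^ (L - M') : ℕ) : ℤ) • d.kolyvaginClass Nat.prime_two L, ⟨?_, ?_⟩, ?_, hdisj⟩
  · exact zsmul_kolyvaginClass_two_mem_selmerGroup_of_forall W Dt β ι hQ2 hcm hK hne3 hne4 hH hodd hsur hL (L - M') hn hKol d hsub
  · rw [conjAct_zsmul_kolyvaginClass_two W Dt β ι hK hne3 hne4 hodd' hH hsurj1 τ hτ hn hL hKol d (L - M'), hsign]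
  · exact addOrderOf_zsmul_kolyvaginClass_two W Dt β ι d hkM hML hordc

/-- **PROP. 5.2 AT `2`, INTRINSIC SEPARATION FORM ⟹ the avoidance binder**: as `avoidance_of_kolyvaginSupply_intrinsic` with the last clause
replaced by «the own primes of `n` separate `C`» (`C ⊓ ⨅_{ℓ∣n} ⨅_{v∣ℓ} ker loc_v = ⊥`, the swap loop's output). [cite: McCallumLMS1991, §5 Prop. 5.2
(proof, p. 310)] -/
theorem avoidance_of_kolyvaginSupply_of_separation_intrinsic (hQ2 : KolyvaginRelationAtTwo) (hcm : ¬ W.HasCM)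
    (hK : IsImaginaryQuadratic K) (hne3 : NumberField.discr K ≠ -3) (hodd' : Odd (NumberField.discr K))
    (hH : SatisfiesHeegnerHypothesis (W.conductorNorm ℤ) K) (hodd : Odd W.tamagawaProduct)
    (hsur : ∀ m : ℕ, W.HasSurjectiveModNGaloisRep (2 ^ m : ℕ)) (hτ : τ ≠ 1)
    (ε : ℤ) {M' k b : ℕ} (hL : 1 ≤ L) (hkM : k ≤ M') (hML : M' ≤ L)
    (C₀ : AddSubgroup (galH1Torsion (W.baseChange K) ((2 ^ L : ℕ) : ℤ)))
    (hP52sep : ∀ (i : ℕ) (u : Fin i → galH1Torsion (W.baseChange K) ((2 ^ L : ℕ) : ℤ)), i ≤ b →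
      (∀ j, u j ∈ selmerGroup (W.baseChange K) ((2 ^ L : ℕ) : ℤ) ∧ conjAct W τ ((2 ^ L : ℕ) : ℤ) (u j) = ε • u j) →
      ∃ (n : ℕ) (_ : Squarefree n)
        (_ : ∀ ℓ ∈ n.primeFactors, Zhang2014.IsKolyvaginPrime (W.conductorNorm ℤ) W K 2 ℓ ∧ L ≤ Zhang2014.kolyvaginIndex W 2 ℓ)
        (d : KolyvaginHeegnerData Dt β ι n),
        (∀ ℓ ∈ n.primeFactors, ∀ e : KolyvaginHeegnerData Dt β ι (n / ℓ),
          ((2 ^ (L - M') : ℕ) : ℤ) • e.kolyvaginClass Nat.prime_two L = 0) ∧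
        addOrderOf (d.kolyvaginClass Nat.prime_two L) = 2 ^ (L - k) ∧
        -W.rootNumber * (-1) ^ n.primeFactors.card = ε ∧
        (AddSubgroup.closure (Set.range u) ⊔ C₀) ⊓
          (⨅ ℓ ∈ n.primeFactors, ⨅ (v : HeightOneSpectrum (𝓞 K)) (_ : ((ℓ : ℕ) : 𝓞 K) ∈ v.asIdeal),
            (W.baseChange K).torsionLocalKer (v.adicCompletion K) ((2 ^ L : ℕ) : ℤ)) = ⊥) :
    ∀ i < b + 1, ∀ u : Fin i → galH1Torsion (W.baseChange K) ((2 ^ L : ℕ) : ℤ),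
      (∀ j, u j ∈ selmerGroup (W.baseChange K) ((2 ^ L : ℕ) : ℤ) ∧ conjAct W τ ((2 ^ L : ℕ) : ℤ) (u j) = ε • u j) →
      (∀ j, addOrderOf (u j) = 2 ^ (M' - k)) →
      ∃ y : galH1Torsion (W.baseChange K) ((2 ^ L : ℕ) : ℤ),
        (y ∈ selmerGroup (W.baseChange K) ((2 ^ L : ℕ) : ℤ) ∧ conjAct W τ ((2 ^ L : ℕ) : ℤ) y = ε • y) ∧
        addOrderOf y = 2 ^ (M' - k) ∧ Disjoint (zmultiples y) (AddSubgroup.closure (Set.range u) ⊔ C₀) := by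
  have hne4 : NumberField.discr K ≠ -4 := fun h ↦ by
    rw [h] at hodd'
    exact (Int.not_even_iff_odd.mpr hodd') ⟨-2, by norm_num⟩
  refine avoidance_of_kolyvaginSupply_intrinsic W Dt β ι τ L hQ2 hcm hK hne3 hodd' hH hodd hsur hτ ε hL hkM hML C₀
    fun i u hi hu ↦ ?_
  obtain ⟨n, hn, hKol, d, hsub, hordc, hsign, hsep⟩ := hP52sep i u hi hu
  refine ⟨n, hn, hKol, d, hsub, hordc, hsign, ?_⟩
  refine disjoint_zmultiples_of_forall_mem (AddSubgroup.closure (Set.range u) ⊔ C₀)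
    (fun ℓ ↦ ⨅ (v : HeightOneSpectrum (𝓞 K)) (_ : ((ℓ : ℕ) : 𝓞 K) ∈ v.asIdeal),
      (W.baseChange K).torsionLocalKer (v.adicCompletion K) ((2 ^ L : ℕ) : ℤ)) n.primeFactors hsep fun ℓ hℓ ↦ ?_
  rw [AddSubgroup.mem_iInf]
  intro v
  rw [AddSubgroup.mem_iInf]
  intro hv
  exact zsmul_kolyvaginClass_two_mem_torsionLocalKer_of_forall W Dt β ι hQ2 hcm hK hne3 hne4 hH hsur hL (L - M') hn hKol d hsub hℓ v hv

end Summit.BirchSwinnertonDyer.BirchSwinnertonDyer.Theorems.GenusExact.PlusDescent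

end
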